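import Mathlib
import Summits.CriticalPhenomena.PercolationContinuityZ3.Theorems.PercNearOneGluingNoHeavyLowerTailOrderedDifferencesUnionClosed

/-!
# Intersection-closed families: 2-chain periodicity and the Marica–Schönheim pencil over every field

Helper file for crux `stmt-CriticalPhenomena-4575` (`NoHeavyLowerTail`, route `PercNearOneGluingNoHeavy`),
new-inequality factory seat `prim-ineq-gen-3` (gen 21).  Everything here is PROVED; no definitions.

The complementation `A ↦ T \ A` (`T` the union of all members) maps an intersection-closed family `𝒜` onto a union-closed family
`𝒜'` with the SAME difference family, exchanging the containment rows `[E ⊆ A]` and the disjointness rows `[E ∩ A = ∅]`; a 2-chain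
`λ → μ → ν` of `𝒜` becomes the 2-chain `ν → μ → λ` of `𝒜'`.  Hence (memo `run/shared/lean/prim/prim-ineq-gen-3/CONJECTURE-P2.md` §10):

* `twoChain_of_interClosed` — intersection-closed families have the 2-chain periodicity property P2
  (from `twoChain_of_unionClosed`);
* `linearIndependent_pencil_of_interClosed` — the pencil rows `A ↦ (E ↦ [E ⊆ A] + t [E ∩ A = ∅])` over `𝒜 \\ 𝒜` are linearly
  independent over EVERY field for every `t` with `t * t ≠ 1`, for every intersection-closed family.
(prim-ineq-gen-3 gen 21, 2026-08-23.)
-/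

namespace Summit.CriticalPhenomena.PercolationContinuityZ3.Theorems

namespace OrderedDifferences

open Finset
open scoped FinsetFamily

variable {α : Type*} [DecidableEq α] {K : Type*} [Field K]

/-- **2-chain periodicity for intersection-closed families** (dual of `twoChain_of_unionClosed` under `A ↦ T \ A`, which turns an
intersection-closed family into a union-closed one and swaps the roles of `Z` and `Y` over the same difference family). -/
theorem twoChain_of_interClosed (𝒜 : Finset (Finset α)) (hI : ∀ A ∈ 𝒜, ∀ B ∈ 𝒜, A ∩ B ∈ 𝒜) (l m n : ↥𝒜 → K)
    (h1 : ∀ E ∈ 𝒜 \\ 𝒜, ∑ A : 𝒜, l A * (if E ⊆ (A : Finset α) then (1 : K) else 0) =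
        ∑ A : 𝒜, m A * (if Disjoint E (A : Finset α) then (1 : K) else 0))
    (h2 : ∀ E ∈ 𝒜 \\ 𝒜, ∑ A : 𝒜, m A * (if E ⊆ (A : Finset α) then (1 : K) else 0) =
        ∑ A : 𝒜, n A * (if Disjoint E (A : Finset α) then (1 : K) else 0)) : l = n := by
  classical
  let T : Finset α := 𝒜.sup id
  have hsub : ∀ A ∈ 𝒜, A ⊆ T := fun A hA => Finset.le_sup (f := id) hA
  let c : Finset α → Finset α := fun A => T \ A
  have hcc : ∀ A ∈ 𝒜, c (c A) = A := fun A hA => by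
    show T \ (T \ A) = A
    rw [sdiff_sdiff_right_self, inf_eq_inter, inter_eq_right.mpr (hsub A hA)]
  have hinj : Set.InjOn c (𝒜 : Set (Finset α)) := fun A hA B hB hAB => by
    have h : c (c A) = c (c B) := congrArg c hAB
    rwa [hcc A hA, hcc B hB] at h
  let 𝒜' : Finset (Finset α) := 𝒜.image c
  have hmem' : ∀ A ∈ 𝒜, c A ∈ 𝒜' := fun A hA => mem_image_of_mem c hA
  have hpre : ∀ X ∈ 𝒜', c X ∈ 𝒜 ∧ c (c X) = X := by
    intro X hX
    obtain ⟨A, hA, rfl⟩ := mem_image.mp hX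
    rw [hcc A hA]
    exact ⟨hA, rfl⟩
  -- `𝒜'` is union-closed
  have hU' : ∀ X ∈ 𝒜', ∀ Y ∈ 𝒜', X ∪ Y ∈ 𝒜' := by
    intro X hX Y hY
    obtain ⟨A, hA, rfl⟩ := mem_image.mp hX
    obtain ⟨B, hB, rfl⟩ := mem_image.mp hY
    refine mem_image.mpr ⟨A ∩ B, hI A hA B hB, ?_⟩
    show T \ (A ∩ B) = T \ A ∪ T \ B
    rw [sdiff_inter_distrib_right]
  -- the difference families coincide
  have hD : 𝒜' \\ 𝒜' = 𝒜 \\ 𝒜 := by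
    ext E
    simp only [mem_diffs]
    constructor
    · rintro ⟨X, hX, Y, hY, rfl⟩
      obtain ⟨A, hA, rfl⟩ := mem_image.mp hX
      obtain ⟨B, hB, rfl⟩ := mem_image.mp hY
      refine ⟨B, hB, A, hA, ?_⟩
      show B \ A = (T \ A) \ (T \ B)
      ext x; simp only [mem_sdiff]
      constructor
      · rintro ⟨hxB, hxA⟩; exact ⟨⟨hsub B hB hxB, hxA⟩, fun h => h.2 hxB⟩
      · rintro ⟨⟨hxT, hxA⟩, h⟩
        exact ⟨by_contra fun hxB => h ⟨hxT, hxB⟩, hxA⟩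
    · rintro ⟨A, hA, B, hB, rfl⟩
      refine ⟨c B, hmem' B hB, c A, hmem' A hA, ?_⟩
      show (T \ B) \ (T \ A) = A \ B
      ext x; simp only [mem_sdiff]
      constructor
      · rintro ⟨⟨hxT, hxB⟩, h⟩
        exact ⟨by_contra fun hxA => h ⟨hxT, hxA⟩, hxB⟩
      · rintro ⟨hxA, hxB⟩; exact ⟨⟨hsub A hA hxA, hxB⟩, fun h => h.2 hxA⟩
  -- transported coefficient vectors on `𝒜'`
  let tr : (↥𝒜 → K) → (↥𝒜' → K) := fun f X => f ⟨c X, (hpre X X.2).1⟩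
  have eZ : ∀ (f : ↥𝒜 → K) (E : Finset α), E ⊆ T →
      ∑ X : 𝒜', tr f X * (if E ⊆ (X : Finset α) then (1 : K) else 0) =
        ∑ A : 𝒜, f A * (if Disjoint E (A : Finset α) then (1 : K) else 0) := by
    intro f E hET
    have e1 : ∑ X : 𝒜', tr f X * (if E ⊆ (X : Finset α) then (1 : K) else 0) =
        ∑ X ∈ 𝒜', (fun X => (if hX : c X ∈ 𝒜 then f ⟨c X, hX⟩ else 0) * (if E ⊆ X then (1 : K) else 0)) X := by
      rw [← Finset.sum_coe_sort 𝒜']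
      refine sum_congr rfl fun X _ => ?_
      simp only [tr, dif_pos (hpre X X.2).1]
    rw [e1, sum_image hinj, ← Finset.sum_coe_sort 𝒜]
    refine sum_congr rfl fun A _ => ?_
    have hcA : c (c A) ∈ 𝒜 := by rw [hcc A A.2]; exact A.2
    simp only [dif_pos hcA]
    have hA : (⟨c (c (A : Finset α)), hcA⟩ : ↥𝒜) = A := Subtype.ext (hcc A A.2)
    rw [hA]
    have hiff : E ⊆ c A ↔ Disjoint E (A : Finset α) := by
      show E ⊆ T \ (A : Finset α) ↔ _
      rw [subset_sdiff]; exact ⟨fun h => h.2, fun h => ⟨hET, h⟩⟩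
    simp only [hiff]
  have eY : ∀ (f : ↥𝒜 → K) (E : Finset α), E ⊆ T →
      ∑ X : 𝒜', tr f X * (if Disjoint E (X : Finset α) then (1 : K) else 0) =
        ∑ A : 𝒜, f A * (if E ⊆ (A : Finset α) then (1 : K) else 0) := by
    intro f E hET
    have e1 : ∑ X : 𝒜', tr f X * (if Disjoint E (X : Finset α) then (1 : K) else 0) =
        ∑ X ∈ 𝒜', (fun X => (if hX : c X ∈ 𝒜 then f ⟨c X, hX⟩ else 0) * (if Disjoint E X then (1 : K) else 0)) X := by
      rw [← Finset.sum_coe_sort 𝒜']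
      refine sum_congr rfl fun X _ => ?_
      simp only [tr, dif_pos (hpre X X.2).1]
    rw [e1, sum_image hinj, ← Finset.sum_coe_sort 𝒜]
    refine sum_congr rfl fun A _ => ?_
    have hcA : c (c A) ∈ 𝒜 := by rw [hcc A A.2]; exact A.2
    simp only [dif_pos hcA]
    have hA : (⟨c (c (A : Finset α)), hcA⟩ : ↥𝒜) = A := Subtype.ext (hcc A A.2)
    rw [hA]
    have hiff : Disjoint E (c A) ↔ E ⊆ (A : Finset α) := by
      show Disjoint E (T \ (A : Finset α)) ↔ _
      rw [Finset.disjoint_left]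
      constructor
      · intro h x hx
        by_contra hxA
        exact h hx (mem_sdiff.mpr ⟨hET hx, hxA⟩)
      · intro h x hx hx'
        exact (mem_sdiff.mp hx').2 (h hx)
    simp only [hiff]
  have hET : ∀ E ∈ 𝒜 \\ 𝒜, E ⊆ T := by
    intro E hE
    obtain ⟨A, hA, B, -, rfl⟩ := mem_diffs.mp hE
    exact sdiff_subset.trans (hsub A hA)
  -- the reversed chain `tr n → tr m → tr l` in the union-closed family `𝒜'`
  have h1' : ∀ E ∈ 𝒜' \\ 𝒜', ∑ X : 𝒜', tr n X * (if E ⊆ (X : Finset α) then (1 : K) else 0) =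
      ∑ X : 𝒜', tr m X * (if Disjoint E (X : Finset α) then (1 : K) else 0) := by
    intro E hE
    rw [hD] at hE
    rw [eZ n E (hET E hE), eY m E (hET E hE)]
    exact (h2 E hE).symm
  have h2' : ∀ E ∈ 𝒜' \\ 𝒜', ∑ X : 𝒜', tr m X * (if E ⊆ (X : Finset α) then (1 : K) else 0) =
      ∑ X : 𝒜', tr l X * (if Disjoint E (X : Finset α) then (1 : K) else 0) := by
    intro E hE
    rw [hD] at hE
    rw [eZ m E (hET E hE), eY l E (hET E hE)]
    exact (h1 E hE).symm
  have key := twoChain_of_unionClosed 𝒜' hU' (tr n) (tr m) (tr l) h1' h2'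
  funext A
  have hcA : c A ∈ 𝒜' := hmem' A A.2
  have := congr_fun key ⟨c A, hcA⟩
  simp only [tr] at this
  have hA : (⟨c (c (A : Finset α)), (hpre (c A) hcA).1⟩ : ↥𝒜) = A := Subtype.ext (hcc A A.2)
  rw [hA] at this
  exact this.symm

/-- **The Marica–Schönheim pencil theorem over every field for intersection-closed families.** -/
theorem linearIndependent_pencil_of_interClosed (𝒜 : Finset (Finset α)) (hI : ∀ A ∈ 𝒜, ∀ B ∈ 𝒜, A ∩ B ∈ 𝒜)
    {t : K} (ht : t * t ≠ 1) :
    LinearIndependent K (fun A : 𝒜 => fun E : (𝒜 \\ 𝒜 : Finset (Finset α)) =>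
      (if (E : Finset α) ⊆ (A : Finset α) then (1 : K) else 0) +
        t * (if Disjoint (E : Finset α) (A : Finset α) then (1 : K) else 0)) := by
  classical
  rw [Fintype.linearIndependent_iff]
  intro c hc
  have hdep : ∀ E ∈ 𝒜 \\ 𝒜, ∑ A : 𝒜, c A * (if E ⊆ (A : Finset α) then (1 : K) else 0) +
      t * ∑ A : 𝒜, c A * (if Disjoint E (A : Finset α) then (1 : K) else 0) = 0 := by
    intro E hE
    have h := congr_fun hc ⟨E, hE⟩
    simp only [Finset.sum_apply, Pi.smul_apply, smul_eq_mul, Pi.zero_apply] at h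
    have e : ∑ A : 𝒜, c A * (if E ⊆ (A : Finset α) then (1 : K) else 0) +
        t * ∑ A : 𝒜, c A * (if Disjoint E (A : Finset α) then (1 : K) else 0) =
        ∑ A : 𝒜, c A * ((if E ⊆ (A : Finset α) then (1 : K) else 0) +
          t * (if Disjoint E (A : Finset α) then (1 : K) else 0)) := by
      rw [mul_sum, ← sum_add_distrib]
      refine sum_congr rfl fun A _ => ?_
      ring
    rw [e]
    exact h
  have h1 : ∀ E ∈ 𝒜 \\ 𝒜, ∑ A : 𝒜, c A * (if E ⊆ (A : Finset α) then (1 : K) else 0) =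
      ∑ A : 𝒜, (-t * c A) * (if Disjoint E (A : Finset α) then (1 : K) else 0) := by
    intro E hE
    have h := hdep E hE
    have e2 : ∑ A : 𝒜, (-t * c A) * (if Disjoint E (A : Finset α) then (1 : K) else 0) =
        -t * ∑ A : 𝒜, c A * (if Disjoint E (A : Finset α) then (1 : K) else 0) := by
      rw [mul_sum]; refine sum_congr rfl fun A _ => ?_; ring
    rw [e2]; linear_combination h
  have h2 : ∀ E ∈ 𝒜 \\ 𝒜, ∑ A : 𝒜, (-t * c A) * (if E ⊆ (A : Finset α) then (1 : K) else 0) =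
      ∑ A : 𝒜, (t * t * c A) * (if Disjoint E (A : Finset α) then (1 : K) else 0) := by
    intro E hE
    have h := h1 E hE
    have e1 : ∑ A : 𝒜, (-t * c A) * (if E ⊆ (A : Finset α) then (1 : K) else 0) =
        -t * ∑ A : 𝒜, c A * (if E ⊆ (A : Finset α) then (1 : K) else 0) := by
      rw [mul_sum]; refine sum_congr rfl fun A _ => ?_; ring
    have e2 : ∑ A : 𝒜, (t * t * c A) * (if Disjoint E (A : Finset α) then (1 : K) else 0) =
        -t * ∑ A : 𝒜, (-t * c A) * (if Disjoint E (A : Finset α) then (1 : K) else 0) := by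
      rw [mul_sum]; refine sum_congr rfl fun A _ => ?_; ring
    rw [e1, e2, h]
  have hcn := twoChain_of_interClosed 𝒜 hI c (fun A => -t * c A) (fun A => t * t * c A) h1 h2
  intro A
  have hA := congr_fun hcn A
  have h3 : (1 - t * t) * c A = 0 := by linear_combination hA
  rcases mul_eq_zero.mp h3 with h4 | h4
  · exact absurd (by linear_combination -h4) ht
  · exact h4

end OrderedDifferences

end Summit.CriticalPhenomena.PercolationContinuityZ3.Theorems
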